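import Literature.NumberTheory.LFunctions.PsiDifferencedExplicitFormula
import Literature.NumberTheory.LFunctions.SchoenfeldThetaLarge
import HarnessLib

/-!
# `|ψ(x) − x| ≤ 0.00862·x + 5.72·√x + 1.838` unconditionally, from the zeros of `ζ` below height `2516`

Topic `Literature/NumberTheory/LFunctions`. Everything here is PROVED (no named facts); like the
tree's `SchoenfeldThetaLarge.lean` it depends on the certified Odlyzko–te Riele computation of the
first `2000` zeros (`MertensCertificate`, `native_decide`, declared computational at the gate).

The `m`-fold differenced explicit formula of `PsiDifferencedExplicitFormula.lean`
(Rosser–Schoenfeld 1975, Lemma 8) is applied with `m = 4`, `h = x/292` and `T = 2516`: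

* `re_eq_half_of_mem_zerosUpTo` — every zero with `|Im ρ| ≤ 2516` has `Re ρ = 1/2`
  (`SchoenfeldZerosLow.zero_eq_of_im_le_heightT0` and conjugation);
* `tailPow_five_le` — `∑_{|Im ρ| > 2516} m(ρ)/|Im ρ|⁵ ≤ 1428/2516⁵ ≈ 1.416·10⁻¹⁴`, by partial
  summation against the explicit `N(t) ≤ N⁺(t)` of `SchoenfeldZeroSumsExplicit.lean`
  (Rosser–Schoenfeld 1975, Lemma 7; antiderivative `Fb5`, `N(2516) = 2000`);
* with `sumInvNorm 2516 ≤ 5.681` (`SchoenfeldZerosLow.lean`):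
  `psi_sub_self_le` : **`ψ(x) − x ≤ 0.00862x + 5.72√x`** (`x ≥ 9`),
  `neg_le_psi_sub_self` : **`ψ(x) − x ≥ −(0.0085x + 5.681√x + 1.838)`** (`x ≥ 2`),
  `abs_psi_sub_self_le` : **`|ψ(x) − x| ≤ 0.00862x + 5.72√x + 1.838`** (`x ≥ 9`).

These are weak but unconditional and fully explicit forms of the prime number theorem in the spirit of
Rosser (1941) and Rosser–Schoenfeld (1962, 1975), whose printed bounds — resting on many more zeros
and on a zero-free region — are far sharper. They supply prime windows `(x, (1+δ)x]` of PNT quality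
for every fixed `δ ≥ 1/20` (`FordPrimeWindowsPNT.lean`: the input "Lemma 2.1" of Ford 2002).

## References

* J. B. Rosser, L. Schoenfeld, Math. Comp. 29 (1975), 243–269, Lemmas 7–8. [RosserSchoenfeld1975]
* L. Schoenfeld, Math. Comp. 30 (1976), 337–360, proof of Thm. 10. [Schoenfeld1976]
* A. M. Odlyzko, H. J. J. te Riele, J. reine angew. Math. 357 (1985), §4.2 (the first 2000 zeros).
  [OdlyzkoTeRiele1985]
-/

noncomputable section

open Real MeasureTheory Set Filter Topology intervalIntegral
open scoped Chebyshev

namespace Literature.NumberTheory.LFunctions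

namespace PsiFromZeros2516

open NicolasJExplicit NicolasJ SchoenfeldBound PsiDifferenced ZetaNumerics.Mertens
open scoped ComplexConjugate

/-! ### All zeros with `|Im ρ| ≤ 2516` lie on the critical line -/

/-- **Every zero of `ζ` with `|Im ρ| ≤ 2516` has real part `1/2`** (the tree's certified first
`2000` zeros, `zero_eq_of_im_le_heightT0`, plus conjugation symmetry).
[cite: OdlyzkoTeRiele1985, §4.2] -/
theorem re_eq_half_of_mem_zerosUpTo {ρ : Zeros} (hρ : ρ ∈ zerosUpTo 2516) : ((ρ : ℂ)).re = 1 / 2 := by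
  have habs := mem_zerosUpTo.1 hρ
  have hz : riemannZeta (ρ : ℂ) = 0 := ZetaZeros.riemannZetaNontrivialZeros.zeta_eq_zero ρ.2
  have hre0 := re_pos' ρ
  have hre1 := re_lt_one ρ.2
  have him0 : ((ρ : ℂ)).im ≠ 0 := ZetaZeros.riemannZetaNontrivialZeros.im_ne_zero ρ.2
  have hT : ((heightT0 : ℕ) : ℝ) = 2516 := by unfold heightT0; norm_num
  rcases lt_or_gt_of_ne him0 with hneg | hpos
  · -- negative ordinate: use the conjugate zero
    have hz' : riemannZeta (conj (ρ : ℂ)) = 0 := by rw [riemannZeta_conj, hz, map_zero]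
    have him' : 0 < (conj (ρ : ℂ)).im := by simp; linarith
    have hle' : (conj (ρ : ℂ)).im ≤ heightT0 := by
      rw [hT]; simp only [Complex.conj_im]; rw [abs_of_neg hneg] at habs; linarith
    obtain ⟨j, -, hj⟩ := zero_eq_of_im_le_heightT0 hz' (by simp; linarith) (by simp; linarith) him' hle'
    have := congrArg Complex.re hj
    simp at this
    linarith
  · have hle : ((ρ : ℂ)).im ≤ heightT0 := by rw [hT]; rw [abs_of_pos hpos] at habs; exact habs
    obtain ⟨j, -, hj⟩ := zero_eq_of_im_le_heightT0 hz hre0.le hre1.le hpos hle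
    have := congrArg Complex.re hj
    simp at this
    linarith

/-! ### The tail `∑_{|Im ρ| > 2516} m(ρ)/|Im ρ|⁵` by partial summation against `N⁺` -/

/-- `d/dt (t^{n+1})⁻¹ = −(n+1)/t^{n+2}`. [folklore] -/
theorem hasDerivAt_inv_pow (n : ℕ) {t : ℝ} (ht : t ≠ 0) :
    HasDerivAt (fun y : ℝ ↦ (y ^ (n + 1))⁻¹) (-((n : ℝ) + 1) / t ^ (n + 2)) t := by
  have h := (hasDerivAt_pow (n + 1) t).inv (pow_ne_zero _ ht)
  refine h.congr_deriv ?_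
  rw [Nat.add_sub_cancel]
  push_cast
  field_simp
  ring

/-- `d/dt (log t · (t^{n+1})⁻¹) = (1 − (n+1) log t)/t^{n+2}`. [folklore] -/
theorem hasDerivAt_log_mul_inv_pow (n : ℕ) {t : ℝ} (ht : 0 < t) :
    HasDerivAt (fun y : ℝ ↦ Real.log y * (y ^ (n + 1))⁻¹) ((1 - ((n : ℝ) + 1) * Real.log t) / t ^ (n + 2)) t := by
  have h := (Real.hasDerivAt_log ht.ne').mul (hasDerivAt_inv_pow n ht.ne')
  refine h.congr_deriv ?_
  field_simp
  ring

/-- `Φ₅`, an antiderivative of `5(N⁺(t) − 2000)/t⁶`: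
`Φ₅(t) = −(5/8π) log t/t⁴ + (5(1+log 2π)/(8π) − 5/(32π))/t⁴ − (7/8 + 34.6 − 2000)/t⁵ − (5·0.3725/6)/t⁶
 − 6.67 log t/t⁵ − (6.67/5)/t⁵`. [cite: RosserSchoenfeld1975, Lemma 7] -/
def Fb5 (t : ℝ) : ℝ :=
  -(5 / (8 * π)) * (Real.log t * (t ^ 4)⁻¹)
  + (5 * (1 + Real.log (2 * π)) / (8 * π) - 5 / (32 * π)) * (t ^ 4)⁻¹
  - (7 / 8 + 34.6 - 2000) * (t ^ 5)⁻¹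
  - (5 * 0.3725 / 6) * (t ^ 6)⁻¹
  - 6.67 * (Real.log t * (t ^ 5)⁻¹)
  - (6.67 / 5) * (t ^ 5)⁻¹

/-- `Φ₅' = (N⁺ − 2000) · 5/t⁶` on `t > 0`. [cite: RosserSchoenfeld1975, Lemma 7] -/
theorem hasDerivAt_Fb5 {t : ℝ} (ht : 0 < t) : HasDerivAt Fb5 ((nUp t - 2000) * (5 / t ^ 6)) t := by
  have h1 := hasDerivAt_log_mul_inv_pow 3 ht
  have h2 := hasDerivAt_inv_pow 3 ht.ne'
  have h3 := hasDerivAt_inv_pow 4 ht.ne'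
  have h4 := hasDerivAt_inv_pow 5 ht.ne'
  have h5 := hasDerivAt_log_mul_inv_pow 4 ht
  have key := (((((h1.const_mul (-(5 / (8 * π)))).add
    (h2.const_mul (5 * (1 + Real.log (2 * π)) / (8 * π) - 5 / (32 * π)))).sub
    (h3.const_mul (7 / 8 + 34.6 - 2000))).sub (h4.const_mul (5 * 0.3725 / 6))).sub
    (h5.const_mul 6.67)).sub (h3.const_mul (6.67 / 5))
  refine key.congr_deriv ?_
  unfold nUp
  push_cast
  field_simp
  ring

/-- `Φ₅` is continuous on `(0, ∞)`. [folklore] -/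
theorem continuousOn_Fb5 : ContinuousOn Fb5 (Ioi 0) := fun _ ht ↦
  (hasDerivAt_Fb5 ht).continuousAt.continuousWithinAt

/-- Auxiliary step (elementary consequence of the definitions and the standing hypotheses). [folklore] -/
theorem log_ge_of_ge_2516 {U : ℝ} (hU : 2516 ≤ U) : 7.8304 ≤ Real.log U :=
  SchoenfeldLarge.log_2516_bounds.1.trans (Real.log_le_log (by norm_num) hU)

/-- The boundary remainder is non-positive: `(N⁺(U) − 2000)/U⁵ + Φ₅(U) ≤ 0` for `U ≥ 2516`
(it equals `(4(1 + log 2π) − 5 − 4 log U)/(32πU⁴) + 0.3725/(6U⁶) − 1.334/U⁵`). [folklore] -/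
theorem boundary_add_Fb5_nonpos {U : ℝ} (hU : 2516 ≤ U) :
    (nUp U - 2000) * (U ^ 5)⁻¹ + Fb5 U ≤ 0 := by
  have hU0 : 0 < U := by linarith
  have hL := log_ge_of_ge_2516 hU
  have hl := SchoenfeldMid.log_two_pi_le
  have hπ : 3 < π := Real.pi_gt_three
  have e : (nUp U - 2000) * (U ^ 5)⁻¹ + Fb5 U =
      ((4 * (1 + Real.log (2 * π)) - 5 - 4 * Real.log U) / (32 * π) * U ^ 2 +
        (0.3725 / 6 - 6.67 / 5 * U)) / U ^ 6 := by
    unfold nUp Fb5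
    field_simp
    ring
  rw [e]
  refine div_nonpos_of_nonpos_of_nonneg ?_ (by positivity)
  have h1 : (4 * (1 + Real.log (2 * π)) - 5 - 4 * Real.log U) / (32 * π) ≤ 0 :=
    div_nonpos_of_nonpos_of_nonneg (by linarith) (by positivity)
  nlinarith [sq_nonneg U]

/-- **`−Φ₅(2516) ≤ 714/2516⁵`** (numerically `−Φ₅(2516)·2516⁵ = 713.2…`; `log 2516 ∈ [7.8304, 7.8305]`,
`log 2π ∈ [1.8378, 1.8379]`). [folklore] -/
theorem neg_Fb5_2516_le : -Fb5 2516 ≤ 714 / 2516 ^ 5 := by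
  have hL := SchoenfeldLarge.log_2516_bounds
  have hl1 := SchoenfeldLarge.log_two_pi_ge
  have hl2 := SchoenfeldMid.log_two_pi_le
  have hπ1 : 3.14159 < π := by linarith [Real.pi_gt_d6]
  have hπ2 : π < 3.1416 := Real.pi_lt_d4
  -- scalar bounds
  have a1 : 5 / (8 * π) ≤ 0.19895 := by
    rw [div_le_iff₀ (by positivity)]; nlinarith
  have a2 : 5 / (32 * π) ≤ 0.04974 := by
    rw [div_le_iff₀ (by positivity)]; nlinarith
  have a3 : 0.56456 ≤ 5 * (1 + Real.log (2 * π)) / (8 * π) := by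
    rw [le_div_iff₀ (by positivity)]; nlinarith
  have e : -Fb5 2516 = ((5 / (8 * π)) * Real.log 2516 * 2516 +
      (5 / (32 * π) - 5 * (1 + Real.log (2 * π)) / (8 * π)) * 2516 +
      (7 / 8 + 34.6 - 2000) + (5 * 0.3725 / 6) / 2516 + 6.67 * Real.log 2516 + 6.67 / 5) / 2516 ^ 5 := by
    unfold Fb5
    field_simp
    ring
  rw [e]
  refine div_le_div_of_nonneg_right ?_ (by positivity)
  have hlog0 : 0 ≤ Real.log 2516 := by linarith [hL.1]
  nlinarith [mul_le_mul a1 hL.2 hlog0 (by norm_num)]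

/-- **Finite tail sums**: for `U ≥ 2516`, `∑_{2516 < Im ρ ≤ U} m(ρ)/(Im ρ)⁵ ≤ −Φ₅(2516)`
(partial summation against `N⁺`, `N(2516) = 2000`). [cite: RosserSchoenfeld1975, Lemma 7] -/
theorem sum_zerosBetween_inv_pow_five_le {U : ℝ} (hU : 2516 ≤ U) :
    ∑ ρ ∈ zerosBetween 2516 U, (riemannZetaZeroOrder ρ : ℝ) * (ρ.im ^ 5)⁻¹ ≤ -Fb5 2516 := by
  have hT0 : (0 : ℝ) ≤ 2516 := by norm_num
  have h := sum_zerosBetween_le_of_count_le hT0 hU (f := fun t ↦ (t ^ 5)⁻¹)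
    (f' := fun t ↦ -((4 : ℝ) + 1) / t ^ (4 + 2)) (Nup := nUp)
    (fun t ht ↦ hasDerivAt_inv_pow 4 (by linarith [ht.1] : t ≠ 0))
    (by
      refine fun t ht ↦ ContinuousAt.continuousWithinAt ?_
      have : t ^ (4 + 2) ≠ 0 := by have := ht.1; positivity
      fun_prop (disch := assumption))
    (fun t ht ↦ div_nonpos_of_nonpos_of_nonneg (by norm_num) (by have := ht.1; positivity))
    (by positivity) (fun t ht ↦ count_le_nUp ht.1) (continuousOn_nUp (by norm_num))
  rw [zetaZeroCount_2516] at h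
  refine h.trans ?_
  -- the integral is `Φ₅(U) − Φ₅(2516)`
  have hint : ∫ t in (2516 : ℝ)..U, (nUp t - 2000) * -(-((4 : ℝ) + 1) / t ^ (4 + 2)) = Fb5 U - Fb5 2516 := by
    have e : (fun t : ℝ ↦ (nUp t - 2000) * -(-((4 : ℝ) + 1) / t ^ (4 + 2))) =
        fun t ↦ (nUp t - 2000) * (5 / t ^ 6) := by
      ext t; norm_num; ring
    rw [e]
    refine intervalIntegral.integral_eq_sub_of_hasDerivAt (fun t ht ↦ hasDerivAt_Fb5 ?_) ?_
    · rw [Set.uIcc_of_le hU] at ht; linarith [ht.1]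
    · refine ContinuousOn.intervalIntegrable_of_Icc hU fun t ht ↦ ContinuousAt.continuousWithinAt ?_
      have : t ≠ 0 := by linarith [ht.1]
      have : t ^ 6 ≠ 0 := by positivity
      have : (2 : ℝ) * π ≠ 0 := by positivity
      unfold nUp
      fun_prop (disch := assumption)
  rw [hint]
  have hb := boundary_add_Fb5_nonpos hU
  linarith

/-- **The tail above height `2516`**: `tailPow 5 2516 = ∑_{|Im ρ| > 2516} m(ρ)/|Im ρ|⁵ ≤ 1428/2516⁵`
(`≈ 1.416·10⁻¹⁴`). [cite: RosserSchoenfeld1975, Lemmas 7–9] -/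
theorem tailPow_five_le : tailPow 5 2516 ≤ 1428 / 2516 ^ 5 := by
  classical
  have hT1 : (1 : ℝ) ≤ 2516 := by norm_num
  have hT0 : (0 : ℝ) ≤ 2516 := by norm_num
  have hB := neg_Fb5_2516_le
  suffices h : tailPow 5 2516 ≤ 2 * (-Fb5 2516) by linarith
  refine hasSum_le_of_sum_le (hasSum_tailPow (by norm_num) hT1) fun s ↦ ?_
  set U : ℝ := 2516 + ∑ ρ ∈ s, |((ρ : ℂ)).im| with hUdef
  have hTU : (2516 : ℝ) ≤ U := by
    rw [hUdef]; linarith [Finset.sum_nonneg (fun ρ (_ : ρ ∈ s) ↦ abs_nonneg (((ρ : Zeros) : ℂ).im))]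
  have hle : ∀ ρ ∈ s, |((ρ : ℂ)).im| ≤ U := fun ρ hρ ↦ by
    rw [hUdef]
    have := Finset.single_le_sum (fun ρ' (_ : ρ' ∈ s) ↦ abs_nonneg (((ρ' : Zeros) : ℂ).im)) hρ
    linarith
  have h1 : ∑ ρ ∈ s, (if ρ ∈ zerosUpTo 2516 then 0 else
      (riemannZetaZeroOrder (ρ : ℂ) : ℝ) / |((ρ : ℂ)).im| ^ 5) ≤
      ∑ ρ ∈ zerosUpTo U \ zerosUpTo 2516, (riemannZetaZeroOrder (ρ : ℂ) : ℝ) / |((ρ : ℂ)).im| ^ 5 := by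
    rw [← Finset.sum_filter_add_sum_filter_not s (fun ρ ↦ ρ ∈ zerosUpTo 2516)]
    rw [Finset.sum_congr rfl (fun ρ hρ ↦ if_pos (Finset.mem_filter.1 hρ).2), Finset.sum_const_zero,
      zero_add, Finset.sum_congr rfl (fun ρ hρ ↦ if_neg (Finset.mem_filter.1 hρ).2)]
    refine Finset.sum_le_sum_of_subset_of_nonneg (fun ρ hρ ↦ ?_) fun ρ _ _ ↦
      div_nonneg (zeroOrder_nonneg' ρ) (by positivity)
    rw [Finset.mem_filter] at hρ
    exact Finset.mem_sdiff.2 ⟨mem_zerosUpTo.2 (hle ρ hρ.1), hρ.2⟩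
  have h2 := sum_sdiff_zerosUpTo_eq_two_mul hT0 (T₂ := U)
    (g := fun z ↦ (riemannZetaZeroOrder z : ℝ) / |z.im| ^ 5)
    (fun z ↦ by simp only [riemannZetaZeroOrder_conj_holds z, Complex.conj_im, abs_neg])
  have h3 : ∑ ρ ∈ zerosBetween 2516 U, (riemannZetaZeroOrder ρ : ℝ) / |ρ.im| ^ 5 =
      ∑ ρ ∈ zerosBetween 2516 U, (riemannZetaZeroOrder ρ : ℝ) * (ρ.im ^ 5)⁻¹ := by
    refine Finset.sum_congr rfl fun ρ hρ ↦ ?_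
    obtain ⟨-, -, -, h3, -⟩ := (mem_zerosBetween hT0).1 hρ
    rw [abs_of_pos (by linarith), div_eq_mul_inv]
  have h4 := sum_zerosBetween_inv_pow_five_le hTU
  linarith

/-! ### The explicit bounds for `ψ` (`m = 4` differences, `h = x/292`) -/

/-- Auxiliary step (elementary consequence of the definitions and the standing hypotheses). [folklore] -/
theorem rpow_three_add_two (y : ℝ) : y ^ (((3 : ℕ) : ℝ) + 2) = y ^ 5 := by
  rw [show (((3 : ℕ) : ℝ) + 2) = ((5 : ℕ) : ℝ) by norm_num, Real.rpow_natCast]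

/-- **`ψ(x) − x ≤ 0.00862·x + 5.72·√x` for `x ≥ 9`** (unconditionally; from the `2000` certified zeros
below height `2516`, `4` differences with `h = x/292`: `4h/2 = x/146`, `√(74x/73)·5.681 ≤ 5.72√x`,
`16(74/73)⁵ 292⁴ · 1428/2516⁵ ≤ 0.001764`, `146/(x²−1) ≤ log 2π`). A weak explicit form of the
prime number theorem in the spirit of Rosser (1941) and Rosser–Schoenfeld (1962, 1975), whose printed
constants are far sharper. [cite: RosserSchoenfeld1975, Lemma 8 (the differencing method; constants here weaker than the printed theorems)] -/
theorem psi_sub_self_le {x : ℝ} (hx : 9 ≤ x) : ψ x - x ≤ 0.00862 * x + 5.72 * Real.sqrt x := by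
  have hx0 : 0 < x := by linarith
  have hx1 : 1 < x := by linarith
  have hh : 0 < x / 292 := by positivity
  have h := psi_sub_self_le_general hh 3 (T := 2516) (by norm_num) (fun ρ hρ ↦ re_eq_half_of_mem_zerosUpTo hρ) hx1
  rw [rpow_three_add_two] at h
  have hS := sumInvNorm_heightT0_le
  have hT : ((heightT0 : ℕ) : ℝ) = 2516 := by unfold heightT0; norm_num
  rw [hT] at hS
  have hτ := tailPow_five_le
  have hτ0 := tailPow_nonneg 5 2516
  have hS0 := sumInvNorm_nonneg (2516 : ℝ)
  -- the pieces
  have e1 : x + ((3 : ℕ) + 1) * (x / 292) = 74 / 73 * x := by push_cast; ring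
  rw [e1] at h
  have p1 : ((3 : ℕ) + 1) * (x / 292) / 2 = x / 146 := by push_cast; ring
  rw [p1] at h
  have p2 : Real.sqrt (74 / 73 * x) * sumInvNorm 2516 ≤ 5.72 * Real.sqrt x := by
    have hs : Real.sqrt (74 / 73 * x) ≤ 1.00683 * Real.sqrt x := by
      have : (74 / 73 : ℝ) * x ≤ (1.00683 * Real.sqrt x) ^ 2 := by
        rw [mul_pow, Real.sq_sqrt hx0.le]; nlinarith
      calc Real.sqrt (74 / 73 * x) ≤ Real.sqrt ((1.00683 * Real.sqrt x) ^ 2) := Real.sqrt_le_sqrt this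
        _ = 1.00683 * Real.sqrt x := Real.sqrt_sq (by positivity)
    calc Real.sqrt (74 / 73 * x) * sumInvNorm 2516 ≤ (1.00683 * Real.sqrt x) * 5.681 :=
          mul_le_mul hs hS hS0 (by positivity)
      _ ≤ 5.72 * Real.sqrt x := by nlinarith [Real.sqrt_nonneg x]
  have p3 : 2 ^ (3 + 1) * (74 / 73 * x) ^ 5 * tailPow (3 + 2) 2516 / (x / 292) ^ (3 + 1) ≤ 0.001764 * x := by
    have e : 2 ^ (3 + 1) * (74 / 73 * x) ^ 5 * tailPow (3 + 2) 2516 / (x / 292) ^ (3 + 1) =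
        (16 * (74 / 73) ^ 5 * 292 ^ 4 * x) * tailPow 5 2516 := by
      field_simp; ring
    rw [e]
    calc (16 * (74 / 73) ^ 5 * 292 ^ 4 * x) * tailPow 5 2516
        ≤ (16 * (74 / 73) ^ 5 * 292 ^ 4 * x) * (1428 / 2516 ^ 5) := mul_le_mul_of_nonneg_left hτ (by positivity)
      _ ≤ 0.001764 * x := by
          rw [show (16 * (74 / 73 : ℝ) ^ 5 * 292 ^ 4 * x) * (1428 / 2516 ^ 5) =
            (16 * (74 / 73 : ℝ) ^ 5 * 292 ^ 4 * (1428 / 2516 ^ 5)) * x by ring]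
          exact mul_le_mul_of_nonneg_right (by norm_num) hx0.le
  have p4 : x / (2 * (x / 292) * (x ^ 2 - 1)) ≤ Real.log (2 * π) := by
    have hl := SchoenfeldLarge.log_two_pi_ge
    have hx2 : 80 ≤ x ^ 2 - 1 := by nlinarith
    have e : x / (2 * (x / 292) * (x ^ 2 - 1)) = 146 / (x ^ 2 - 1) := by
      field_simp; ring
    rw [e, div_le_iff₀ (by linarith)]
    nlinarith
  linarith

/-- **`ψ(x) − x ≥ −(0.0085·x + 5.681·√x + 1.838)` for `x ≥ 2`** (same method, lower side).
[cite: RosserSchoenfeld1975, Lemma 8 (the differencing method; constants here weaker than the printed theorems)] -/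
theorem neg_le_psi_sub_self {x : ℝ} (hx : 2 ≤ x) : -(0.0085 * x + 5.681 * Real.sqrt x + 1.838) ≤ ψ x - x := by
  have hx0 : 0 < x := by linarith
  have hh : 0 < x / 292 := by positivity
  have hx1 : 1 < x - ((3 : ℕ) + 1) * (x / 292) := by push_cast; linarith
  have h := neg_le_psi_sub_self_general hh 3 (T := 2516) (by norm_num)
    (fun ρ hρ ↦ re_eq_half_of_mem_zerosUpTo hρ) hx1
  rw [rpow_three_add_two] at h
  have hS := sumInvNorm_heightT0_le
  have hT : ((heightT0 : ℕ) : ℝ) = 2516 := by unfold heightT0; norm_num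
  rw [hT] at hS
  have hτ := tailPow_five_le
  have hτ0 := tailPow_nonneg 5 2516
  have hS0 := sumInvNorm_nonneg (2516 : ℝ)
  have hl := SchoenfeldMid.log_two_pi_le
  have p1 : ((3 : ℕ) + 1) * (x / 292) / 2 = x / 146 := by push_cast; ring
  rw [p1] at h
  have p2 : Real.sqrt x * sumInvNorm 2516 ≤ 5.681 * Real.sqrt x := by
    rw [mul_comm]; exact mul_le_mul_of_nonneg_right hS (Real.sqrt_nonneg x)
  have p3 : 2 ^ (3 + 1) * x ^ 5 * tailPow (3 + 2) 2516 / (x / 292) ^ (3 + 1) ≤ 0.001648 * x := by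
    have e : 2 ^ (3 + 1) * x ^ 5 * tailPow (3 + 2) 2516 / (x / 292) ^ (3 + 1) =
        (16 * 292 ^ 4 * x) * tailPow 5 2516 := by
      field_simp; ring
    rw [e]
    calc (16 * 292 ^ 4 * x) * tailPow 5 2516
        ≤ (16 * 292 ^ 4 * x) * (1428 / 2516 ^ 5) := mul_le_mul_of_nonneg_left hτ (by positivity)
      _ ≤ 0.001648 * x := by
          rw [show (16 * (292 : ℝ) ^ 4 * x) * (1428 / 2516 ^ 5) = (16 * (292 : ℝ) ^ 4 * (1428 / 2516 ^ 5)) * x by ring]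
          exact mul_le_mul_of_nonneg_right (by norm_num) hx0.le
  linarith

/-- **`|ψ(x) − x| ≤ 0.00862·x + 5.72·√x + 1.838` for `x ≥ 9`.**
[cite: RosserSchoenfeld1975, Lemma 8 (the differencing method; constants here weaker than the printed theorems)] -/
theorem abs_psi_sub_self_le {x : ℝ} (hx : 9 ≤ x) : |ψ x - x| ≤ 0.00862 * x + 5.72 * Real.sqrt x + 1.838 := by
  have h1 := psi_sub_self_le hx
  have h2 := neg_le_psi_sub_self (show (2 : ℝ) ≤ x by linarith)
  have hs := Real.sqrt_nonneg x
  rw [abs_le]; constructor <;> nlinarith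

end PsiFromZeros2516

end Literature.NumberTheory.LFunctions
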